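import Mathlib
import Summits.Langlands.Langlands.Theses.NonParallelVoid
import Literature.NumberTheory.GaloisRepresentations.ToLocalRestrictField
import Literature.NumberTheory.GaloisRepresentations.PinnedDatumLabels
import Literature.NumberTheory.EllipticCurves.NewformGaloisRepPadicAlgClProofs
import HarnessLib

/-!
# Helper `stub_labelExtension` of stub `stub_ordinaryDihedralVoid` (crux `TensorSquareParallel`,
# stmt-Langlands-17009, line `merged`, skeleton v2)

Number-field plumbing ("label extension"): for number fields `F ⊆ E`, a place `v ∣ p` of `F`, a label
`τ : F_v →ₐ[ℚ_p] ℚ̄_p` (for the `ℚ_p`-structure of THE pinned datum `fontainePstAdicCompletion v p hv`)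
and a ring embedding `e : E → ℚ̄_p` extending the global embedding `τ ∘ (F → F_v)`, there are a place
`w ∣ v` of `E` above `p` and a label `τ' : E_w →ₐ[ℚ_p] ℚ̄_p` (pinned structure at `w`) extending both
`e` (along `E → E_w`) and `τ` (along the local base-change map `F_v → E_w`,
`adicCompletionOfLiesOver`).

Proof (all ingredients are theorems of the tree): `w` is the place of `E` cut out by `|e ·|_p`
(`exists_heightOneSpectrum_of_ringHom_padicAlgCl`, Neukirch ANT II §8), `e` extends to a continuous
`φ : E_w → ℚ̄_p` (`exists_continuous_ringHom_adicCompletion_padicAlgCl`), which is a label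
`τ' = PinnedLabel.ofContinuous` (a continuous ring map out of `E_w` is `ℚ_p`-linear for the pinned =
canonical structure); the label `τ'.below F = (w ∩ 𝓞 F, τ' ∘ (F_v → E_w))` of `F` has the same global
embedding `e|_F = τ|_F` as `τ`, so by RIGIDITY of pinned labels (`PinnedLabel.place_eq`,
`PinnedLabel.eq_of_emb_eq`: a label is determined by its global embedding) `w ∩ 𝓞 F = v` and
`τ' ∘ (F_v → E_w) = τ`.
-/

noncomputable section

set_option linter.dupNamespace false  -- `Summit.Langlands.Langlands.…` is the mandated summit-side namespace (D-0022)

open scoped NumberField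
open IsDedekindDomain Field
open Literature.NumberTheory.GaloisRepresentations Literature.NumberTheory.PAdicHodge
  Literature.NumberTheory.Automorphic

namespace Summit.Langlands.Langlands.Theorems.TensorSquareParallel

/-- **Label extension (plumbing for `stub_ordinaryDihedralVoid`).**  For number fields `F ⊆ E`, a
place `v ∣ p` of `F`, a label `τ : F_v →ₐ[ℚ_p] ℚ̄_p` for the `ℚ_p`-structure of the pinned datum
`fontainePstAdicCompletion v p hv`, and a ring embedding `e : E → ℚ̄_p` with
`e ∘ (F → E) = τ ∘ (F → F_v)`, there are a place `w` of `E` lying over `v` (hence above `p`) and a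
label `τ' : E_w →ₐ[ℚ_p] ℚ̄_p` (pinned structure at `w`) with `τ' ∘ (E → E_w) = e` and
`τ' ∘ (F_v → E_w) = τ`.  Here `w` is the place cut out by `|e ·|_p` and `τ'` the continuous extension
of `e` to `E_w` (Neukirch, ANT Ch. II §8, (8.1)–(8.2) and pp. 160–161); `w ∣ v` and
`τ' ∘ (F_v → E_w) = τ` follow from the rigidity of pinned labels (a label is determined by its global
embedding: `PinnedLabel.place_eq`, `PinnedLabel.eq_of_emb_eq`) applied to the label of `F` below
`(w, τ')`. [cite: NeukirchANT1999, Ch. II §8 (pp. 160–161) with (8.1)–(8.2)] -/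
theorem stub_labelExtension :
    ∀ (F E : Type) [Field F] [NumberField F] [Field E] [NumberField E] [Algebra F E] (p : ℕ) [Fact p.Prime] (v : HeightOneSpectrum (𝓞 F)) (hv : ((p : ℕ) : 𝓞 F) ∈ v.asIdeal) (τ : @AlgHom ℚ_[p] (v.adicCompletion F) (PadicAlgCl p) _ _ _ (fontainePstAdicCompletion v p hv).algebra _) (e : E →+* PadicAlgCl p), e.comp (algebraMap F E) = (@AlgHom.toRingHom ℚ_[p] (v.adicCompletion F) (PadicAlgCl p) _ _ _ (fontainePstAdicCompletion v p hv).algebra _ τ).comp (algebraMap F (v.adicCompletion F)) → ∃ (w : HeightOneSpectrum (𝓞 E)) (_ : w.asIdeal.LiesOver v.asIdeal) (hw : ((p : ℕ) : 𝓞 E) ∈ w.asIdeal), letI := (fontainePstAdicCompletion w p hw).algebra; ∃ τ' : w.adicCompletion E →ₐ[ℚ_[p]] PadicAlgCl p, τ'.toRingHom.comp (algebraMap E (w.adicCompletion E)) = e ∧ τ'.toRingHom.comp (adicCompletionOfLiesOver F E v w) = @AlgHom.toRingHom ℚ_[p] (v.adicCompletion F) (PadicAlgCl p) _ _ _ (fontainePstAdicCompletion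 v p hv).algebra _ τ := by
  intro F E _ _ _ _ _ p _ v hv τ e he
  -- the place `w ∋ p` of `E` cut out by `e`, and the continuous extension `φ : E_w → ℚ̄_p` of `e`
  obtain ⟨w, hpw, hjw⟩ :=
    Literature.NumberTheory.EllipticCurves.exists_heightOneSpectrum_of_ringHom_padicAlgCl e
  obtain ⟨φ, hφc, hφ⟩ :=
    Literature.NumberTheory.EllipticCurves.exists_continuous_ringHom_adicCompletion_padicAlgCl
      e w hpw hjw
  -- `φ` is a label `τ'` at `w` (continuity ⇒ `ℚ_p`-linearity for the pinned structure)
  set τ' : PinnedLabel p w hpw := PinnedLabel.ofContinuous w hpw φ hφc with hτ'def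
  have hτ'hom : τ'.toHom = φ := PinnedLabel.toHom_ofContinuous φ hφc
  have hτ'emb : τ'.emb = e := by
    refine RingHom.ext fun x => ?_
    change τ'.toHom (algebraMap E (w.adicCompletion E) x) = e x
    rw [hτ'hom, hφ]
  -- the label of `F` below `(w, τ')` has the same global embedding as `τ`
  have hτ : PinnedLabel.emb (p := p) (v := v) (hv := hv) τ = e.comp (algebraMap F E) := he.symm
  have hbelow : (τ'.below F).emb = PinnedLabel.emb (p := p) (v := v) (hv := hv) τ := by
    rw [PinnedLabel.emb_below, hτ'emb, hτ]
  -- rigidity: `w ∩ 𝓞 F = v` and `τ'.below F = τ`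
  obtain rfl : w.under (𝓞 F) = v := PinnedLabel.place_eq (τ'.below F) τ hbelow
  have heq : τ'.below F = τ := PinnedLabel.eq_of_emb_eq (τ'.below F) τ hbelow
  haveI hlo : w.asIdeal.LiesOver (w.under (𝓞 F)).asIdeal := liesOver_under (F := F) w
  refine ⟨w, hlo, hpw, τ', ?_, ?_⟩
  · exact hτ'emb
  · have h1 := PinnedLabel.toHom_below F τ'
    rw [heq] at h1
    exact h1.symm

end Summit.Langlands.Langlands.Theorems.TensorSquareParallel

end
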